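import Mathlib

/-!
# Helpers for stub `stub_hadamardLocallyConvexIsConvex` (A1) of line `Sketch`
(crux `AhHadamardFilling`, item stmt-SmoothPoincare4-6014): the metric core of Tietze–Nakajima–Karcher

Pure metric-space lemmas behind the registered helper stub `stub_hadamardConvexityToolkit`: in a
proper metric space with (i) geodesics (isometric copies of `[0, d(x,y)]` joining `x` to `y`),
(ii) propagation of betweenness along distinct points (`b ∈ [a,c]`, `c ∈ [b,d]`, `b ≠ c` ⇒
`c ∈ [a,d]`) and (iii) splitting of segments (`b, m ∈ [a,c]` ⇒ `m ∈ [a,b] ∪ [b,c]`), a closed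
connected set which is locally convex in the betweenness sense is convex in that sense.  Proof
(Tietze 1928 / Nakajima 1928, discrete curve shortening): `C` is chain connected with a length
budget (open-closed argument, walking along local segments); a uniform convexity radius `η` on the
compact region of such chains (Lebesgue number); a shortest `η/2`-chain with the least number of
vertices exists (compactness), has every vertex between its neighbours (else move it to the segment
of its neighbours, inside `C`) and no repeated vertex, so by (ii), (iii) `[p,q] = ⋃ [vᵢ,vᵢ₊₁] ⊆ C`.
The Riemannian input (i)–(iii) is supplied in `…StubHadamardLocallyConvexIsConvex.lean`.  References:
H. Tietze, Math. Z. 28 (1928); S. Nakajima, Tôhoku Math. J. 29 (1928); H. Karcher, Math. Ann. 177 (1968).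
-/

noncomputable section

-- the prescribed namespace `Summit.<P>.<Sub>.…` duplicates `SmoothPoincare4` (P = Sub)
set_option linter.dupNamespace false

open Set Function Filter Metric Topology

namespace Summit.SmoothPoincare4.SmoothPoincare4.Cruxes.AhHadamardFilling.Sketch

/-! ## 1. Step chains

In §§1–2, `Ch e x N` is the set of **`e`-chains in `C` from `p` to `x` with at most `N` steps**
(`v : ℕ → Y`, `v 0 = p`, `v i = x` for `i ≥ N`, vertices in `C`, consecutive vertices at distance
`≤ e`) and `len N v = ∑_{i<N} d(vᵢ, vᵢ₊₁)`; both enter through their defining equations. -/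

variable {Y : Type*} [MetricSpace Y] {C : Set Y} {p : Y} {Ch : ℝ → Y → ℕ → Set (ℕ → Y)}
  (hCh : ∀ (e : ℝ) (x : Y) (N : ℕ) (v : ℕ → Y), v ∈ Ch e x N ↔
    v 0 = p ∧ (∀ i, N ≤ i → v i = x) ∧ (∀ i, v i ∈ C) ∧ ∀ i, dist (v i) (v (i + 1)) ≤ e)
  {len : ℕ → (ℕ → Y) → ℝ}
  (hlen : ∀ (N : ℕ) (v : ℕ → Y), len N v = ∑ i ∈ Finset.range N, dist (v i) (v (i + 1)))

include hCh hlen in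
/-- One-point extension of a chain by a vertex `y ∈ C` at distance `≤ e` from its end point. [folklore] -/
theorem extend_mem_chains {e : ℝ} {x : Y} {N : ℕ} {v : ℕ → Y}
    (h : v ∈ Ch e x N) {y : Y} (hy : y ∈ C) (hxy : dist x y ≤ e) :
    (fun i ↦ if i ≤ N then v i else y) ∈ Ch e y (N + 1) ∧
      len (N + 1) (fun i ↦ if i ≤ N then v i else y) = len N v + dist x y := by
  obtain ⟨h0, hN, hC, hstep⟩ := (hCh _ _ _ _).1 h
  rw [hCh, hlen, hlen]
  refine ⟨⟨by simp [h0], fun i hi ↦ by simp [show ¬ i ≤ N by omega], fun i ↦ ?_, fun i ↦ ?_⟩, ?_⟩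
  · by_cases hi : i ≤ N <;> simp [hi, hC i, hy]
  · by_cases hi : i + 1 ≤ N
    · rw [if_pos hi, if_pos (show i ≤ N by omega)]; exact hstep i
    · by_cases hi' : i ≤ N
      · rw [if_pos hi', if_neg hi, hN i (by omega)]; exact hxy
      · rw [if_neg hi', if_neg hi, dist_self]; exact dist_nonneg.trans hxy
  · rw [Finset.sum_range_succ]
    congr 1
    · refine Finset.sum_congr rfl fun i hi ↦ ?_
      rw [Finset.mem_range] at hi
      simp [show i ≤ N by omega, show i + 1 ≤ N by omega]
    · simp [hN N le_rfl]

include hCh hlen in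
/-- **The vertices of a chain stay within its length of the initial point.** [folklore] -/
theorem dist_le_of_mem_chains {e : ℝ} {x : Y} {N : ℕ} {v : ℕ → Y}
    (h : v ∈ Ch e x N) (i : ℕ) : dist p (v i) ≤ len N v := by
  obtain ⟨h0, hN, -, -⟩ := (hCh _ _ _ _).1 h
  have key : ∀ i, dist p (v i) ≤ ∑ j ∈ Finset.range i, dist (v j) (v (j + 1)) := by
    intro i
    induction i with
    | zero => simp [h0]
    | succ k ih =>
      rw [Finset.sum_range_succ]
      linarith [dist_triangle p (v k) (v (k + 1))]
  rw [hlen]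
  by_cases hi : i ≤ N
  · exact (key i).trans
      (Finset.sum_le_sum_of_subset_of_nonneg (Finset.range_mono hi) fun _ _ _ ↦ dist_nonneg)
  · rw [hN i (by omega), ← hN N le_rfl]
    exact key N

include hCh hlen in
/-- Deleting a repeated vertex of a chain with `N + 1` steps gives a chain with `N` steps. [folklore] -/
theorem delete_mem_chains {e : ℝ} {x : Y} {N : ℕ} {v : ℕ → Y}
    (h : v ∈ Ch e x (N + 1)) {k : ℕ} (hk : k ≤ N) (hdup : v k = v (k + 1)) :
    (fun i ↦ if i ≤ k then v i else v (i + 1)) ∈ Ch e x N ∧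
      len N (fun i ↦ if i ≤ k then v i else v (i + 1)) ≤ len (N + 1) v := by
  obtain ⟨h0, hN, hC, hstep⟩ := (hCh _ _ _ _).1 h
  rw [hCh, hlen, hlen]
  refine ⟨⟨by simp [h0], fun i hi ↦ ?_, fun i ↦ ?_, fun i ↦ ?_⟩, ?_⟩
  · by_cases hik : i ≤ k
    · rw [if_pos hik, show i = k by omega, hdup]; exact hN _ (by omega)
    · rw [if_neg hik]; exact hN _ (by omega)
  · by_cases hik : i ≤ k <;> simp [hik, hC]
  · by_cases hi : i + 1 ≤ k
    · rw [if_pos hi, if_pos (show i ≤ k by omega)]; exact hstep i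
    · by_cases hi' : i ≤ k
      · rw [if_pos hi', if_neg hi, show i = k by omega, hdup]; exact hstep (k + 1)
      · rw [if_neg hi', if_neg hi]; exact hstep (i + 1)
  · set f : ℕ → ℝ := fun i ↦ dist (v i) (v (i + 1)) with hf
    set f' : ℕ → ℝ := fun i ↦ dist (if i ≤ k then v i else v (i + 1))
      (if i + 1 ≤ k then v (i + 1) else v (i + 1 + 1)) with hf'
    have h1 : ∑ i ∈ Finset.range k, f' i = ∑ i ∈ Finset.range k, f i :=
      Finset.sum_congr rfl fun i hi ↦ by
        rw [Finset.mem_range] at hi; simp [hf', hf, show i ≤ k by omega, hi]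
    have h2 : ∑ i ∈ Finset.Ico k N, f' i = ∑ i ∈ Finset.Ico (k + 1) (N + 1), f i := by
      rw [← Finset.sum_Ico_add' f k N 1]
      refine Finset.sum_congr rfl fun i hi ↦ ?_
      rw [Finset.mem_Ico] at hi
      by_cases hik : i = k; · subst hik; simp [hf', hf, hdup]
      simp [hf', hf, show ¬ i ≤ k by omega, show ¬ i < k by omega]
    have h3 : ∑ i ∈ Finset.Ico k (N + 1), f i = f k + ∑ i ∈ Finset.Ico (k + 1) (N + 1), f i :=
      Finset.sum_eq_sum_Ico_succ_bot (by omega) f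
    have hfk : 0 ≤ f k := dist_nonneg
    calc ∑ i ∈ Finset.range N, f' i
        = ∑ i ∈ Finset.range k, f' i + ∑ i ∈ Finset.Ico k N, f' i :=
          (Finset.sum_range_add_sum_Ico f' hk).symm
      _ ≤ ∑ i ∈ Finset.range k, f i + ∑ i ∈ Finset.Ico k (N + 1), f i := by
          rw [h1, h2, h3]; linarith
      _ = ∑ i ∈ Finset.range (N + 1), f i := Finset.sum_range_add_sum_Ico f (by omega)

/-! ## 2. Chain connectedness of connected locally convex sets, with a length budget -/

include hCh hlen in
/-- **Walking along a segment**: if every between-point of `x, y` lies in `C`, an `e`-chain in `C`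
ending at `x` extends to one ending at `y`, the length growing by at most `d(x, y)` (subdivide a
geodesic from `x` to `y` into steps of length `≤ e`). [folklore] -/
theorem walk_mem_chains
    (hgeo : ∀ x y : Y, ∃ γ : ℝ → Y, γ 0 = x ∧ γ (dist x y) = y ∧
      ∀ s t : ℝ, 0 ≤ s → s ≤ t → t ≤ dist x y → dist (γ s) (γ t) = t - s)
    {e : ℝ} {x : Y} {N : ℕ} {v : ℕ → Y} (h : v ∈ Ch e x N)
    (he : 0 < e) {y : Y} (hseg : ∀ m, dist x m + dist m y = dist x y → m ∈ C) :
    ∃ (N' : ℕ) (v' : ℕ → Y), v' ∈ Ch e y N' ∧ len N' v' ≤ len N v + dist x y := by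
  obtain ⟨γ, hγ0, hγ1, hγ⟩ := hgeo x y
  have hd : 0 ≤ dist x y := dist_nonneg
  have main : ∀ k : ℕ, ∃ (N' : ℕ) (v' : ℕ → Y),
      v' ∈ Ch e (γ (min (k * e) (dist x y))) N' ∧
      len N' v' ≤ len N v + min (k * e) (dist x y) := by
    intro k
    induction k with
    | zero =>
      refine ⟨N, v, ?_, ?_⟩
      · simpa [min_eq_left hd, hγ0] using h
      · simp
    | succ k ih =>
      obtain ⟨N', v', h', hL'⟩ := ih
      have hs0 : 0 ≤ min ((k : ℝ) * e) (dist x y) := le_min (by positivity) hd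
      have hss' : min ((k : ℝ) * e) (dist x y) ≤ min (((k + 1 : ℕ) : ℝ) * e) (dist x y) :=
        min_le_min_right _ (by push_cast; nlinarith)
      have hs'd : min (((k + 1 : ℕ) : ℝ) * e) (dist x y) ≤ dist x y := min_le_right _ _
      have hstep : min (((k + 1 : ℕ) : ℝ) * e) (dist x y) - min ((k : ℝ) * e) (dist x y) ≤ e := by
        have h1 : min (((k + 1 : ℕ) : ℝ) * e) (dist x y) ≤ min ((k : ℝ) * e + e) (dist x y + e) := by
          push_cast; rw [add_one_mul]; exact min_le_min_left _ (by linarith)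
        rw [min_add_add_right] at h1
        linarith
      have hdist := hγ _ _ hs0 hss' hs'd
      have hmem : γ (min (((k + 1 : ℕ) : ℝ) * e) (dist x y)) ∈ C := by
        have h1 := hγ 0 _ le_rfl (hs0.trans hss') hs'd
        have h2 := hγ _ _ (hs0.trans hss') hs'd le_rfl
        rw [hγ0] at h1; rw [hγ1] at h2; exact hseg _ (by linarith)
      obtain ⟨h'', hL''⟩ := extend_mem_chains hCh hlen h' hmem (by rw [hdist]; exact hstep)
      exact ⟨_, _, h'', by rw [hL'']; linarith⟩
  obtain ⟨N', v', h', hL'⟩ := main ⌈dist x y / e⌉₊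
  have hmin : min ((⌈dist x y / e⌉₊ : ℕ) * e) (dist x y) = dist x y :=
    min_eq_right (by have h1 := Nat.le_ceil (dist x y / e); rwa [div_le_iff₀ he] at h1)
  rw [hmin, hγ1] at h'; rw [hmin] at hL'; exact ⟨N', v', h', hL'⟩

include hCh hlen in
/-- **Connected locally convex sets are chain connected with a length budget**: there is `L` such
that for every `e > 0` some `e`-chain in `C` of length `≤ L` joins `p` to `q` (open-closed argument,
`IsPreconnected.induction₂'`, each step walking along a local segment). [folklore] -/
theorem exists_mem_chains
    (hgeo : ∀ x y : Y, ∃ γ : ℝ → Y, γ 0 = x ∧ γ (dist x y) = y ∧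
      ∀ s t : ℝ, 0 ≤ s → s ≤ t → t ≤ dist x y → dist (γ s) (γ t) = t - s)
    (hconn : IsPreconnected C)
    (hloc : ∀ p ∈ C, ∃ δ : ℝ, 0 < δ ∧ ∀ q ∈ C, ∀ q' ∈ C, dist p q < δ → dist p q' < δ →
      ∀ m : Y, dist q m + dist m q' = dist q q' → m ∈ C)
    (hp : p ∈ C) {q : Y} (hq : q ∈ C) :
    ∃ L : ℝ, ∀ e : ℝ, 0 < e → ∃ (N : ℕ) (v : ℕ → Y), v ∈ Ch e q N ∧ len N v ≤ L := by
  have key := hconn.induction₂' (fun x y ↦ ∃ c : ℝ, ∀ e : ℝ, 0 < e → ∀ L : ℝ,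
      (∃ (N : ℕ) (v : ℕ → Y), v ∈ Ch e x N ∧ len N v ≤ L) →
      ∃ (N : ℕ) (v : ℕ → Y), v ∈ Ch e y N ∧ len N v ≤ L + c) ?_ ?_ hp hq
  · obtain ⟨c, hc⟩ := key
    refine ⟨0 + c, fun e he ↦ hc e he 0 ⟨0, fun _ ↦ p, (hCh _ _ _ _).2 ⟨rfl, fun _ _ ↦ rfl,
      fun _ ↦ hp, fun _ ↦ by simpa using he.le⟩, by simp [hlen]⟩⟩
  · intro x hx
    obtain ⟨δ, hδ, hδC⟩ := hloc x hx
    have hmem : C ∩ ball x δ ∈ 𝓝[C] x := inter_mem_nhdsWithin C (ball_mem_nhds x hδ)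
    filter_upwards [hmem] with y hy
    obtain ⟨hyC, hyx⟩ := hy
    rw [mem_ball] at hyx
    have hxx : dist x x < δ := by simpa using hδ
    have hxy : dist x y < δ := by rwa [dist_comm]
    refine ⟨⟨dist x y, fun e he L hL ↦ ?_⟩, ⟨dist y x, fun e he L hL ↦ ?_⟩⟩
    · obtain ⟨N, v, hv, hvL⟩ := hL
      obtain ⟨N', v', h', hL'⟩ := walk_mem_chains hCh hlen hgeo hv he (hδC x hx y hyC hxx hxy)
      exact ⟨N', v', h', hL'.trans (by linarith)⟩
    · obtain ⟨N, v, hv, hvL⟩ := hL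
      obtain ⟨N', v', h', hL'⟩ := walk_mem_chains hCh hlen hgeo hv he (hδC y hyC x hx hxy hxx)
      exact ⟨N', v', h', hL'.trans (by linarith)⟩
  · rintro x y z - - - ⟨c, hc⟩ ⟨c', hc'⟩
    refine ⟨c + c', fun e he L hL ↦ ?_⟩
    have h := hc' e he (L + c) (hc e he L hL)
    rwa [add_assoc] at h

/-! ## 3. Local-to-global convexity: the metric core (the registered helper stub) -/

/-- **A uniform convexity radius on compact pieces** (Lebesgue number of the cover of `K ∩ C`
by the balls of local convexity). [folklore] -/
theorem exists_uniform_radius {C K : Set Y} (hK : IsCompact K) (hC : IsClosed C)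
    (hloc : ∀ p ∈ C, ∃ δ : ℝ, 0 < δ ∧ ∀ q ∈ C, ∀ q' ∈ C, dist p q < δ → dist p q' < δ →
      ∀ m : Y, dist q m + dist m q' = dist q q' → m ∈ C) :
    ∃ η : ℝ, 0 < η ∧ ∀ z ∈ K ∩ C, ∀ q ∈ C, ∀ q' ∈ C, dist z q < η → dist z q' < η →
      ∀ m : Y, dist q m + dist m q' = dist q q' → m ∈ C := by
  choose δ hδ hδC using hloc
  have hcover : K ∩ C ⊆ ⋃ z : C, ball (z : Y) (δ z z.2) := fun z hz ↦
    mem_iUnion.2 ⟨⟨z, hz.2⟩, mem_ball_self (hδ z hz.2)⟩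
  obtain ⟨η, hη, hηK⟩ :=
    lebesgue_number_lemma_of_metric (hK.inter_right hC) (fun _ ↦ isOpen_ball) hcover
  refine ⟨η, hη, fun z hz q hq q' hq' hzq hzq' ↦ ?_⟩
  obtain ⟨⟨w, hw⟩, hwz⟩ := hηK z hz
  have h1 : ∀ a, dist z a < η → dist w a < δ w hw := fun a ha ↦ by
    have h := hwz (mem_ball.2 (by rwa [dist_comm] at ha))
    rwa [mem_ball, dist_comm] at h
  exact hδC w hw q hq q' hq' (h1 q hzq) (h1 q' hzq')

/-- **Toolkit of stub A1 = the metric core of Tietze–Nakajima–Karcher** (registered helper stub of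
`stub_hadamardLocallyConvexIsConvex`): in a proper metric space with geodesics, propagating and
splitting betweenness, a closed connected set which is locally convex in the betweenness sense is
convex in that sense (discrete curve shortening, see the file docstring). [folklore] -/
theorem stub_hadamardConvexityToolkit :
    ∀ (Y : Type) [MetricSpace Y] [ProperSpace Y],
    (∀ x y : Y, ∃ γ : ℝ → Y, γ 0 = x ∧ γ (dist x y) = y ∧
      ∀ s t : ℝ, 0 ≤ s → s ≤ t → t ≤ dist x y → dist (γ s) (γ t) = t - s) →
    (∀ a b c d : Y, dist a b + dist b c = dist a c → dist b c + dist c d = dist b d →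
      b ≠ c → dist a c + dist c d = dist a d) →
    (∀ a b c m : Y, dist a b + dist b c = dist a c → dist a m + dist m c = dist a c →
      dist a m + dist m b = dist a b ∨ dist b m + dist m c = dist b c) →
    ∀ (C : Set Y), IsClosed C → IsConnected C →
    (∀ p ∈ C, ∃ δ : ℝ, 0 < δ ∧ ∀ q ∈ C, ∀ q' ∈ C, dist p q < δ → dist p q' < δ →
      ∀ m : Y, dist q m + dist m q' = dist q q' → m ∈ C) →
    ∀ p ∈ C, ∀ q ∈ C, ∀ m : Y, dist p m + dist m q = dist p q → m ∈ C := by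
  classical
  intro Y _ _ hgeo hprop hsplit C hC hconn hloc p hp q hq
  -- (0) `e`-chains in `C` from `p` and their length
  set Ch : ℝ → Y → ℕ → Set (ℕ → Y) := fun e x N ↦
    {v | v 0 = p ∧ (∀ i, N ≤ i → v i = x) ∧ (∀ i, v i ∈ C) ∧ ∀ i, dist (v i) (v (i + 1)) ≤ e} with hChdef
  have hCh : ∀ (e : ℝ) (x : Y) (N : ℕ) (v : ℕ → Y), v ∈ Ch e x N ↔ v 0 = p ∧
      (∀ i, N ≤ i → v i = x) ∧ (∀ i, v i ∈ C) ∧ ∀ i, dist (v i) (v (i + 1)) ≤ e := fun _ _ _ _ ↦ Iff.rfl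
  set len : ℕ → (ℕ → Y) → ℝ := fun N v ↦ ∑ i ∈ Finset.range N, dist (v i) (v (i + 1)) with hlendef
  have hlen : ∀ N v, len N v = ∑ i ∈ Finset.range N, dist (v i) (v (i + 1)) := fun _ _ ↦ rfl
  -- (1) a length budget for chains from `p` to `q`, and a uniform radius on that region
  obtain ⟨L, hL⟩ := exists_mem_chains hCh hlen hgeo hconn.isPreconnected hloc hp hq
  obtain ⟨η, hη, hηC⟩ := exists_uniform_radius (isCompact_closedBall p L) hC hloc
  set e : ℝ := η / 2 with he
  have he0 : 0 < e := by positivity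
  have heη : e < η := by rw [he]; linarith
  -- (2) the least number of steps, and a shortest chain with that number of steps
  have hex : ∃ N : ℕ, ∃ v : ℕ → Y, v ∈ Ch e q N ∧ len N v ≤ L := hL e he0
  set N₀ := Nat.find hex with hN₀
  have hN₀spec : ∃ v : ℕ → Y, v ∈ Ch e q N₀ ∧ len N₀ v ≤ L := Nat.find_spec hex
  have hN₀min : ∀ N, (∃ v : ℕ → Y, v ∈ Ch e q N ∧ len N v ≤ L) → N₀ ≤ N :=
    fun N h ↦ Nat.find_min' hex h
  set S : Set (ℕ → Y) := {v | v ∈ Ch e q N₀ ∧ len N₀ v ≤ L} with hS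
  have hSK : ∀ v ∈ S, ∀ i, v i ∈ closedBall p L ∩ C := fun v hv i ↦
    ⟨by rw [mem_closedBall, dist_comm]; exact (dist_le_of_mem_chains hCh hlen hv.1 i).trans hv.2,
      ((hCh _ _ _ _).1 hv.1).2.2.1 i⟩
  have hlenc : Continuous fun v : ℕ → Y ↦ len N₀ v :=
    continuous_finsetSum _ fun i _ ↦ (continuous_apply i).dist (continuous_apply (i + 1))
  have hScl : IsClosed S := by
    simp only [hS, hChdef, setOf_and, setOf_forall, setOf_mem_eq]
    exact ((isClosed_eq (continuous_apply 0) continuous_const).inter ((isClosed_iInter fun i ↦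
      isClosed_iInter fun _ ↦ isClosed_eq (continuous_apply i) continuous_const).inter
      ((isClosed_iInter fun i ↦ hC.preimage (continuous_apply i)).inter (isClosed_iInter fun i ↦
      isClosed_le ((continuous_apply i).dist (continuous_apply (i + 1))) continuous_const)))).inter
      (isClosed_le hlenc continuous_const)
  have hScpt : IsCompact S :=
    (isCompact_univ_pi fun _ : ℕ ↦ isCompact_closedBall p L).of_isClosed_subset hScl
      fun v hv i _ ↦ (hSK v hv i).1
  obtain ⟨v, hvS, hmin⟩ := hScpt.exists_isMinOn hN₀spec hlenc.continuousOn
  obtain ⟨hv0, hvN, hvC, hvstep⟩ := (hCh _ _ _ _).1 hvS.1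
  -- (3) no repeated vertices before the end (minimality of `N₀`)
  have hnodup : ∀ k, k < N₀ → v k ≠ v (k + 1) := by
    intro k hk hdup
    obtain ⟨M, hM⟩ : ∃ M, N₀ = M + 1 := ⟨N₀ - 1, by omega⟩
    have hv' : v ∈ Ch e q (M + 1) := by rw [← hM]; exact hvS.1
    obtain ⟨h', hL'⟩ := delete_mem_chains hCh hlen hv' (show k ≤ M by omega) hdup
    have := hN₀min M ⟨_, h', hL'.trans (by rw [← hM]; exact hvS.2)⟩
    omega
  -- (4) every vertex is between its neighbours (minimality of the length)
  have hbtw : ∀ i, dist (v i) (v (i + 1)) + dist (v (i + 1)) (v (i + 2)) = dist (v i) (v (i + 2)) := by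
    intro i
    by_contra hne
    have hlt : dist (v i) (v (i + 2)) < dist (v i) (v (i + 1)) + dist (v (i + 1)) (v (i + 2)) :=
      lt_of_le_of_ne (dist_triangle _ _ _) (Ne.symm hne)
    have hiN : i + 1 < N₀ := by
      by_contra hle; push Not at hle; apply hne
      rw [hvN (i + 1) hle, hvN (i + 2) (by omega), dist_self, add_zero]
    -- the proportional point `m` of the segment `[v i, v (i+2)]`
    set a := v i with ha
    set b := v (i + 1) with hb
    set c := v (i + 2) with hc
    obtain ⟨γ, hγ0, hγ1, hγ⟩ := hgeo a c
    set σ : ℝ := dist a b + dist b c with hσ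
    have hσ0 : 0 < σ := lt_of_le_of_lt dist_nonneg hlt
    set s : ℝ := dist a c * dist a b / σ with hs
    have hs0 : 0 ≤ s := by positivity
    have hsD : s ≤ dist a c := by
      rw [hs, div_le_iff₀ hσ0, hσ]
      nlinarith [dist_nonneg (x := a) (y := c), dist_nonneg (x := b) (y := c)]
    set m := γ s with hm
    have ham : dist a m = s := by
      have h := hγ 0 s le_rfl hs0 hsD
      rwa [hγ0, sub_zero] at h
    have hmc : dist m c = dist a c - s := by
      have h := hγ s (dist a c) hs0 hsD le_rfl
      rwa [hγ1] at h
    have ham' : dist a m ≤ dist a b := by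
      rw [ham, hs, div_le_iff₀ hσ0, hσ]
      nlinarith [dist_nonneg (x := a) (y := b)]
    have hmc' : dist m c ≤ dist b c := by
      rw [hmc, hs, sub_le_iff_le_add, ← sub_le_iff_le_add', le_div_iff₀ hσ0, hσ]
      nlinarith [dist_nonneg (x := b) (y := c)]
    have hmC : m ∈ C := by
      refine hηC b (hSK v hvS (i + 1)) a (hvC i) c (hvC (i + 2)) ?_ ?_ m (by rw [ham, hmc]; ring)
      · rw [dist_comm]; exact (hvstep i).trans_lt heη
      · exact (hvstep (i + 1)).trans_lt heη
    -- the competitor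
    set w : ℕ → Y := Function.update v (i + 1) m with hw
    have hwi : w i = a := by rw [hw, Function.update_of_ne (by omega)]
    have hwi1 : w (i + 1) = m := by rw [hw, Function.update_self]
    have hwi2 : w (i + 2) = c := by rw [hw, Function.update_of_ne (by omega)]
    have hwj : ∀ j, j ≠ i + 1 → w j = v j := fun j hj ↦ by rw [hw, Function.update_of_ne hj]
    have hwS : w ∈ Ch e q N₀ := by
      refine (hCh _ _ _ _).2 ⟨by rw [hwj 0 (by omega), hv0],
        fun j hj ↦ by rw [hwj j (by omega), hvN j hj], fun j ↦ ?_, fun j ↦ ?_⟩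
      · by_cases hj : j = i + 1
        · rw [hj, hwi1]; exact hmC
        · rw [hwj j hj]; exact hvC j
      · by_cases hj : j = i
        · rw [hj, hwi, hwi1]; exact ham'.trans (hvstep i)
        · by_cases hj' : j = i + 1
          · rw [hj', hwi1, hwi2]; exact hmc'.trans (hvstep (i + 1))
          · rw [hwj j hj', hwj (j + 1) (by omega)]; exact hvstep j
    have hterm : ∀ j, dist (w j) (w (j + 1)) ≤ dist (v j) (v (j + 1)) := by
      intro j
      by_cases hj : j = i
      · rw [hj, hwi, hwi1]; exact ham'
      · by_cases hj' : j = i + 1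
        · rw [hj', hwi1, hwi2]; exact hmc'
        · rw [hwj j hj', hwj (j + 1) (by omega)]
    have hstrict : len N₀ w < len N₀ v := by
      rw [hlen, hlen]
      refine Finset.sum_lt_sum (fun j _ ↦ hterm j) ?_
      rcases lt_or_ge (dist a m) (dist a b) with h1 | h1
      · exact ⟨i, Finset.mem_range.2 (by omega), by rwa [hwi, hwi1]⟩
      · refine ⟨i + 1, Finset.mem_range.2 hiN, ?_⟩
        rw [hwi1, hwi2]
        have h2 : dist a m = dist a b := le_antisymm ham' h1
        linarith [ham, hmc]
    have hle : len N₀ v ≤ len N₀ w := hmin ⟨hwS, (hstrict.le.trans hvS.2)⟩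
    exact absurd hle (not_le.2 hstrict)
  -- (5) consecutive segments lie in `C`
  have hseg : ∀ i, ∀ m : Y, dist (v i) m + dist m (v (i + 1)) = dist (v i) (v (i + 1)) → m ∈ C :=
    fun i ↦ hηC (v i) (hSK v hvS i) (v i) (hvC i) (v (i + 1)) (hvC (i + 1)) (by simpa using hη)
      ((hvstep i).trans_lt heη)
  -- (6) induction along the chain
  have hind : ∀ k, (∀ m : Y, dist (v 0) m + dist m (v k) = dist (v 0) (v k) → m ∈ C) ∧
      dist (v 0) (v k) + dist (v k) (v (k + 1)) = dist (v 0) (v (k + 1)) := by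
    intro k
    induction k with
    | zero =>
      refine ⟨fun m hm ↦ ?_, by simp⟩
      rw [dist_self] at hm
      have h0 : dist (v 0) m = 0 := by linarith [dist_nonneg (x := v 0) (y := m), dist_nonneg (x := m) (y := v 0)]
      rw [dist_eq_zero] at h0
      rw [← h0, hv0]
      exact hp
    | succ k ih =>
      obtain ⟨ih1, ih2⟩ := ih
      refine ⟨fun m hm ↦ ?_, ?_⟩
      · rcases hsplit (v 0) (v k) (v (k + 1)) m ih2 hm with h | h
        · exact ih1 m h
        · exact hseg k m h
      · by_cases hk : k < N₀
        · exact hprop (v 0) (v k) (v (k + 1)) (v (k + 2)) ih2 (hbtw k) (hnodup k hk)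
        · push Not at hk
          rw [hvN (k + 1) (by omega), hvN (k + 2) (by omega), dist_self, add_zero]
  intro m hm
  have h := (hind N₀).1 m
  rw [hv0, hvN N₀ le_rfl] at h
  exact h hm

end Summit.SmoothPoincare4.SmoothPoincare4.Cruxes.AhHadamardFilling.Sketch

end
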